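import Literature.Analysis.FunctionSpaces.LorentzOne
import HarnessLib

/-!
# Lorentz `L^{p,q}` membership, `0 < q < ∞` (the distribution-function form)

Analysis/FunctionSpaces definition file, companion of `LorentzOne.lean` (`L^{p,1}`) and
`WeakLp.lean` (`L^{p,∞}`), whose conventions it copies (superlevel sets `{x | t < ‖f x‖ₑ}`,
exponents through `toReal`). The **Lorentz space** `L^{p,q}(μ)`, `0 < p < ∞`, `0 < q < ∞`,
consists of the measurable `f` with finite quasinorm; by Grafakos, *Classical Fourier Analysis*,
3rd ed., Prop. 1.4.9 the quasinorm `‖f‖_{L^{p,q}} = (∫₀^∞ (t^{1/p} f*(t))^q dt/t)^{1/q}`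
(Def. 1.4.6, `f*` the decreasing rearrangement) equals
`p^{1/q} (∫₀^∞ (s d_f(s)^{1/p})^q ds/s)^{1/q}`, `d_f(s) = μ{x : |f(x)| > s}` — the form in which
Phuc (J. Math. Fluid Mech. 17 (2015), p. 744) DEFINES it:
`‖g‖_{L^{p,q}(Ω)} := (p ∫₀^∞ α^q |{x ∈ Ω : |g(x)| > α}|^{q/p} dα/α)^{1/q}` if `q < ∞`,
`sup_{α>0} α |{|g| > α}|^{1/p}` if `q = ∞`. Mathlib has no decreasing rearrangement and no Lorentz
spaces, so, as in `LorentzOne.lean`, we vendor the distribution-function form.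

This file defines
* `eLorentzNormPow f p q μ = ∫⁻ t ∈ (0,∞), t^{q-1} · μ{x | t < ‖f x‖}^{q/p} dt` — `p⁻¹` times the
  `q`-TH POWER `‖f‖^q_{L^{p,q}}` of the quasinorm in the Grafakos/Phuc normalisation, valued in
  `ℝ≥0∞` (we keep the power, not its `q`-th root: finiteness and bounds are what consumers state;
  exponents through `p.toReal`, `q.toReal` as in `MeasureTheory.eLpNorm`; for `q ∈ {0, ∞}` the
  value is junk — `L^{p,∞}` is `eWeakLpPow` of `WeakLp.lean`);
* `MemLorentz f p q μ` — `f ∈ L^{p,q}(μ)`: a.e.-strongly measurable with finite `eLorentzNormPow`;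
and proves: unfolding, the case `q = 1` is `eLorentzOneNorm` (`LorentzOne.lean`), `0 ∈ L^{p,q}` for
`0 < p, q < ∞`, and monotonicity in the measure. No instance, no notation (typer lint rule).
Consumer: `Literature/Analysis/FluidPDE/LorentzSpaceRegularityCriteria.lean` (Phuc 2015 Thms 1.5,
1.7; Lemarié-Rieusset 2016 Thm 15.6: the class `L^∞_t L^{3,q}_x`, `q < ∞`).

## Mathlib / tree search

Mathlib: `MeasureTheory.eLpNorm`/`MemLp` only (`lean search 'Lorentz' --decl`: Lorentz gas /
group; 2026-08-28). Tree: `eLorentzOneNorm`/`MemLorentzOne` (`q = 1`), `eWeakLpPow`/`MemWeakLp`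
(`q = ∞`); nothing for general `q`.

## References

* L. Grafakos, *Classical Fourier Analysis*, 3rd ed., GTM 249 (2014), §1.4.2: Def. 1.4.6,
  Prop. 1.4.9 (distribution-function formula), Prop. 1.4.10 (nesting). [Grafakos2014]
* N. C. Phuc, J. Math. Fluid Mech. 17 (2015) 741–760 = arXiv:1407.5129, p. 744 (definition of
  `L^{p,q}(Ω)` through the distribution function). [Phuc2015]
-/

noncomputable section

open MeasureTheory Set Function Filter
open scoped ENNReal NNReal Topology

namespace Literature.Analysis.FunctionSpaces

variable {α : Type*} [MeasurableSpace α] {E : Type*} [NormedAddCommGroup E]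

/-- The **Lorentz `L^{p,q}` functional** (`0 < q < ∞`) in distribution-function form,
`eLorentzNormPow f p q μ = ∫₀^∞ t^{q-1} μ{x | t < ‖f x‖}^{q/p} dt`
(`= p⁻¹ ‖f‖^q_{L^{p,q}}` in the normalisation of Grafakos, Prop. 1.4.9 / Phuc 2015 p. 744:
`‖f‖_{L^{p,q}} = (p ∫₀^∞ t^q d_f(t)^{q/p} dt/t)^{1/q}`). The exponents enter through `p.toReal`,
`q.toReal`; for `q = 0` or `q = ∞` the value is junk (documented in the module docstring).
[cite: Grafakos2014, Prop. 1.4.9] [cite: Phuc2015, p. 744 (definition of L^{p,q})] -/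
def eLorentzNormPow (f : α → E) (p q : ℝ≥0∞) (μ : Measure α) : ℝ≥0∞ :=
  ∫⁻ t in Ioi (0 : ℝ), ENNReal.ofReal (t ^ (q.toReal - 1)) *
    μ {x | ENNReal.ofReal t < ‖f x‖ₑ} ^ (q.toReal / p.toReal)

/-- **Lorentz `L^{p,q}` membership** (`0 < q < ∞`), `f ∈ L^{p,q}(μ)`: `f` is a.e.-strongly
measurable and `∫₀^∞ t^{q-1} μ{|f| > t}^{q/p} dt < ∞` (Grafakos, Def. 1.4.6 with Prop. 1.4.9).
[cite: Grafakos2014, Def. 1.4.6 and Prop. 1.4.9] -/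
def MemLorentz (f : α → E) (p q : ℝ≥0∞) (μ : Measure α) : Prop :=
  AEStronglyMeasurable f μ ∧ eLorentzNormPow f p q μ < ∞

variable {f : α → E} {p q : ℝ≥0∞} {μ ν : Measure α}

/-- Unfolding lemma for `eLorentzNormPow` (the distribution-function form of Grafakos,
Prop. 1.4.9). [cite: Grafakos2014, Prop. 1.4.9] -/
theorem eLorentzNormPow_def (f : α → E) (p q : ℝ≥0∞) (μ : Measure α) :
    eLorentzNormPow f p q μ =
      ∫⁻ t in Ioi (0 : ℝ), ENNReal.ofReal (t ^ (q.toReal - 1)) *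
        μ {x | ENNReal.ofReal t < ‖f x‖ₑ} ^ (q.toReal / p.toReal) :=
  rfl

/-- Unfolding lemma for `MemLorentz` (Grafakos, Def. 1.4.6 read through Prop. 1.4.9).
[cite: Grafakos2014, Def. 1.4.6 and Prop. 1.4.9] -/
theorem memLorentz_iff :
    MemLorentz f p q μ ↔ AEStronglyMeasurable f μ ∧ eLorentzNormPow f p q μ < ∞ :=
  Iff.rfl

/-- A member of `L^{p,q}` is a.e.-strongly measurable (by definition; Grafakos, Def. 1.4.6).
[cite: Grafakos2014, Def. 1.4.6] -/
theorem MemLorentz.aestronglyMeasurable (h : MemLorentz f p q μ) : AEStronglyMeasurable f μ :=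
  h.1

/-- A member of `L^{p,q}` has finite Lorentz functional (by definition; Grafakos, Def. 1.4.6).
[cite: Grafakos2014, Def. 1.4.6] -/
theorem MemLorentz.eLorentzNormPow_lt_top (h : MemLorentz f p q μ) :
    eLorentzNormPow f p q μ < ∞ :=
  h.2

/-- **The case `q = 1` is the `L^{p,1}` functional of `LorentzOne.lean`**:
`eLorentzNormPow f p 1 μ = eLorentzOneNorm f p μ` (`t^0 = 1`, exponent `1/p`; Grafakos,
Prop. 1.4.9 at `q = 1`). [cite: Grafakos2014, Prop. 1.4.9 (q = 1)] -/
theorem eLorentzNormPow_one (f : α → E) (p : ℝ≥0∞) (μ : Measure α) :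
    eLorentzNormPow f p 1 μ = eLorentzOneNorm f p μ := by
  unfold eLorentzNormPow eLorentzOneNorm
  refine setLIntegral_congr_fun measurableSet_Ioi fun t _ => ?_
  rw [ENNReal.toReal_one, sub_self, Real.rpow_zero, ENNReal.ofReal_one, one_mul, one_div]

/-- The zero function has zero Lorentz functional for `0 < p < ∞`, `0 < q < ∞` (its superlevel
sets `{t < ‖0‖}`, `t > 0`, are empty and `0^{q/p} = 0`; Grafakos, Def. 1.4.6: `‖0‖ = 0`).
[cite: Grafakos2014, Def. 1.4.6] -/
theorem eLorentzNormPow_zero (hp : 0 < p.toReal) (hq : 0 < q.toReal) :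
    eLorentzNormPow (0 : α → E) p q μ = 0 := by
  have hset : ∀ t : ℝ, {x : α | ENNReal.ofReal t < ‖(0 : α → E) x‖ₑ} = ∅ := by
    intro t
    ext x
    simp
  unfold eLorentzNormPow
  simp_rw [hset, measure_empty, ENNReal.zero_rpow_of_pos (div_pos hq hp), mul_zero, lintegral_zero]

/-- `0 ∈ L^{p,q}` for `0 < p, q < ∞` (Grafakos, Def. 1.4.6: a linear space). [cite: Grafakos2014, Def. 1.4.6] -/
theorem memLorentz_zero (hp0 : p ≠ 0) (hptop : p ≠ ∞) (hq0 : q ≠ 0) (hqtop : q ≠ ∞) :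
    MemLorentz (0 : α → E) p q μ :=
  ⟨aestronglyMeasurable_const, by
    rw [eLorentzNormPow_zero (ENNReal.toReal_pos hp0 hptop) (ENNReal.toReal_pos hq0 hqtop)]
    exact ENNReal.zero_lt_top⟩

/-- **Monotonicity in the measure**: `μ ≤ ν` implies
`eLorentzNormPow f p q μ ≤ eLorentzNormPow f p q ν` (the distribution function is monotone in the
measure; for a restricted measure this is `L^{p,q}(Ω) ⊆`-monotonicity in `Ω`, Phuc p. 744).
[cite: Grafakos2014, Def. 1.1.1 (distribution function) with Prop. 1.4.9] -/
theorem eLorentzNormPow_mono_measure (f : α → E) (p q : ℝ≥0∞) (hμν : μ ≤ ν) :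
    eLorentzNormPow f p q μ ≤ eLorentzNormPow f p q ν := by
  unfold eLorentzNormPow
  refine lintegral_mono fun t => ?_
  gcongr

/-- For `t ≥ 0` the extended and the real superlevel sets agree (restatement of
`setOf_ofReal_lt_enorm_eq` of `LorentzOne.lean` for the present functional): the integrand of
`eLorentzNormPow` may be read with `{x | t < ‖f x‖}`. [cite: Grafakos2014, Def. 1.1.1 (distribution function)] -/
theorem eLorentzNormPow_eq_lintegral_setOf_lt_norm (f : α → E) (p q : ℝ≥0∞) (μ : Measure α) :
    eLorentzNormPow f p q μ =
      ∫⁻ t in Ioi (0 : ℝ), ENNReal.ofReal (t ^ (q.toReal - 1)) *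
        μ {x | t < ‖f x‖} ^ (q.toReal / p.toReal) := by
  unfold eLorentzNormPow
  refine setLIntegral_congr_fun measurableSet_Ioi fun t ht => ?_
  rw [setOf_ofReal_lt_enorm_eq f (le_of_lt ht)]

end Literature.Analysis.FunctionSpaces

end
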